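import Literature.Computability.AlgebraicComplexity.RegularDetComplexityDetCubic
import HarnessLib

/-!
# `rdc(det_m) ≤ (m³ − m)/3 + 1` — Ikenmeyer–Landsberg 2017, Prop. 2.3, via the pruned
# Mahajan–Vinay layered branching program (ibid. §3, Prop. 3.2 and Lemma 3.3)

Discharge (D-0014) of the named fact
`Literature.Computability.AlgebraicComplexity.ikenmeyerLandsberg2017_prop_2_3`
(`LR17EquivariantRepresentations.lean`): over `ℂ`, for every `m`, `det_m` has a REGULAR affine
determinantal representation (`IsRegularDetRepr`: affine entries, `det = det_m`, constant part of
rank `size − 1`) of some size `≤ (m³ − m)/3 + 1` — C. Ikenmeyer, J. M. Landsberg, *On the complexity of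
the permanent in various computational models*, J. Pure Appl. Algebra 221 (2017) = arXiv:1610.00159
[IkenmeyerLandsberg2017], read as `paper:arxiv-1610.00159`: **Prop. 2.3** p0004:L66
"`rdc(det_m) ≤ ⅓(m³ − m) + 1`" (answering Landsberg–Ressayre's Question 2.18), proved in §3 p0006 from
**Prop. 3.1** (`rdc(P) ≤ labpc(P) − 1` when `P(0) = 0`; in tree as the matrix identity
`GKKP2011.det_fromBlocks_abp` + `GKKP2011.rank_constPart_fromBlocks_abp`, file
`RegularDetComplexityDetCubic.lean`, cell val-lit t12) and **Prop. 3.2** "`labpc(det_m) ≤ m³/3 − m/3 + 2`"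
with **Lemma 3.3** (the vertex count; "the number of vertices in layer `i ∈ {1,…,m−1}` is
`i(i+1)/2 + i(m−i)`" — so in the proof, p0006:L52–L54; the statement line of the held text prints
`i(m−1)`, a typo) = "an analysis of the algorithm in [MV:97] with all improvements that are described in
the article", an explicit layered program `Γ` on the vertices `(h,u,i)` (p0006:L38–L44, edges
p0006:L57–L64), whose value is `det_m` "by [MV:97]" (p0006:L65).

## The printed proof and what is formalised

IL17's `Γ` (p0006): layer `i` (= number of edges used) carries the states `(h, u)` = (head of the
current clow = its LEAST vertex, current vertex), restricted to `h ≤ min(i, u)` plus the fresh head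
`(i+1, i+1, i)`; edges continue the clow (`x^u_v`, `v > h`) or close it and open the next head `h' > h`
(`−x^u_h`); the last edge closes into the sink with the sign `α = ±1` (parity of `m`). The restriction is
Mahajan–Vinay's pruning: a clow sequence that survives to a cycle cover opens its `j`-th head at a layer
`s_j ≥ h_j − 1`.

This file builds the same program in the tree's **Berkowitz orientation** (heads = LARGEST vertex,
heads increasing along the sequence — `SymmetricDetRepresentationProofs.lean`, Part B, whose signed
one-layer transfer matrix `GKKP2011.T₀` and dynamics `GKKP2011.sv` we reuse verbatim), which is IL17's
`Γ` read from the sink to the source after the relabelling `v ↦ m + 1 − v` of `{1,…,m}` (this reverses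
both the orientation of the heads and the order of the layers; the per-layer counts match IL17's in the
reversed order, `card_vtx` gives the printed total `(m³ − m)/3` of internal vertices, i.e. Lemma 3.3's
`m³/3 − m/3 + 2` with source and sink). Concretely, for `m = n + 2`: the internal vertices (`Vtx n`) are
the LIVE states `(t, u)` at the layers `d = 1, …, m − 1` (`Alive`): inside a clow, `u < t`, iff `d ≤ t`;
a closed head `(t, t)` iff `d − 1 ≤ t ≤ m − 2` — exactly the states through which an `s`–`t` path of
the unpruned program can pass with a nonzero contribution. The adjacency matrix `prN`, source weights
`prSrc` and sink weights `prSnk` are the RESTRICTIONS of the unpruned signed program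
(`fullN`/`fullSrc`/`fullSnk` on all `(m−1)·m²` layer-states) to `Vtx n`.

Correctness (`abpValue_prN_eq_detPoly`: `a · (1 + N)⁻¹ · b = det_m`) is NOT the clow-sequence
involution of [MV:97] but the tree's algebraic invariant `GKKP2011.sv_spec` (Berkowitz's recursion):
the value carried by a closed head `(t,t)` after `d` edges is `e (t+1) d − e t d`, which VANISHES for
`d > t + 1` (`GKKP2011.e_of_lt`) — so every state we drop either carries `0` or has no live successor
(`alive_of_ne_zero`), and the pruned program has the same value as the unpruned one
(`prSrc_vecMul_pow`), namely `[X⁰] χ(M_m) · (−1)^m = det_m`. After the pruning no Cayley–Hamilton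
cancellation of over-long clows is needed (contrast `GKKP2011.abpValue_eq_detPoly`).

Then Prop. 3.1 (t12's `det_fromBlocks_abp`, `rank_constPart_fromBlocks_abp`) gives the regular matrix
`[[0, −aᵀ], [b, 1 + N]]` of size `|Vtx n| + 1 = (m³ − m)/3 + 1` on the nose
(`hasRegularDetRepr_detPoly_add_two`, every field); `m = 0, 1` are the empty matrix and `(X₀₀)`
(`hasRegularDetRepr_detPoly_zero/one`); `regularDetComplexity_detPoly_le_il17` is Prop. 2.3 over every
field and `ikenmeyerLandsberg2017_prop_2_3_holds` the discharge as stated (over `ℂ`).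

Deviations from the printed proof: (i) orientation/reading direction as said (a relabelling of the same
graph; the clow sign sits on the closing edge in both); (ii) the correctness argument is Berkowitz's
recursion instead of [MV:97]'s involution; (iii) the root row/column signs are those of
`det_fromBlocks_abp` (`−aᵀ`), harmless for regularity and for the value. No new definitions of notions
(only the explicit program), no named facts (D-0026).

Honest framing: an upper bound for the determinant in a restricted model, formalising a published
construction; nothing here bears on lower bounds or on VP versus VNP.

## References

* [IkenmeyerLandsberg2017] C. Ikenmeyer, J. M. Landsberg, *On the complexity of the permanent in
  various computational models*, J. Pure Appl. Algebra 221 (2017), arXiv:1610.00159, Prop. 2.3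
  (p0004:L66), §3: Prop. 3.1, Prop. 3.2, Lemma 3.3 (p0006).
* [MahajanVinay1997] M. Mahajan, V. Vinay, *Determinant: combinatorics, algorithms, and complexity*,
  Chicago J. Theoret. Comput. Sci. 1997, Art. 5, §3 (the layered program and its pruning).
* [LandsbergRessayre2017] J. M. Landsberg, N. Ressayre, arXiv:1508.05788, Def. 2.12 (`rdc`),
  Question 2.18.
-/

noncomputable section

namespace Literature.Computability.AlgebraicComplexity

open MvPolynomial _root_.Matrix

namespace IL17

open _root_.Matrix Finset MvPolynomial Berkowitz GKKP2011

universe u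

variable (k : Type u) [CommRing k] (n : ℕ)

/-! ## The live states (IL17 Prop. 3.2: the vertex set of `Γ`, Berkowitz orientation, `m = n + 2`) -/

/-- The layer-states of the unpruned signed Mahajan–Vinay program for `det_{n+2}`: a layer index
`i : Fin (n+1)` (the state is reached after `i + 1` edges) and a state `(t, u)` of `GKKP2011.T₀`
(head `t`, current vertex `u`; `u = t` = the clow with head `t` has just been closed).
[cite: IkenmeyerLandsberg2017, Prop. 3.2 (proof)] -/
abbrev LState : Type := Fin (n + 1) × (Fin (n + 2) × Fin (n + 2))

/-- **IL17's pruning** (the vertex set of `Γ`, p0006:L38–L44, in Berkowitz orientation): after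
`d = i + 1` edges the state `(t, u)` is LIVE iff either it is inside a clow (`u < t`) with `d ≤ t`, or it
is a closed head (`u = t`) with `d − 1 ≤ t ≤ m − 2` (`m = n + 2`). [cite: IkenmeyerLandsberg2017, Prop. 3.2 (proof)] -/
abbrev Alive (p : LState n) : Prop :=
  ((p.2.2 : ℕ) < p.2.1 ∧ (p.1 : ℕ) < p.2.1) ∨ (p.2.2 = p.2.1 ∧ (p.1 : ℕ) ≤ p.2.1 ∧ (p.2.1 : ℕ) ≤ n)

/-- The internal vertices of the pruned program = IL17's `Γ` without source and sink
(`card_vtx`: there are `(m³ − m)/3` of them). [cite: IkenmeyerLandsberg2017, Prop. 3.2 (proof)] -/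
abbrev Vtx : Type := {p : LState n // Alive n p}

/-! ## The unpruned signed program on all layer-states and its restriction -/

/-- Adjacency matrix of the UNPRUNED signed program: from layer `i` to layer `i + 1` by the signed
transfer matrix `GKKP2011.T₀` (continue a clow `X_{uv}`, close it `−X_{ut}`, open the next head).
[cite: IkenmeyerLandsberg2017, Prop. 3.2 (proof)] -/
def fullN : Matrix (LState n) (LState n) (MvPolynomial (Fin (n + 2) × Fin (n + 2)) k) :=
  Matrix.of fun p p' => if (p'.1 : ℕ) = p.1 + 1 then T₀ k (n + 2) p.2 p'.2 else 0

/-- Source weights of the unpruned program: the first edge opens the first clow (`GKKP2011.start₀`),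
into layer `0`. [cite: IkenmeyerLandsberg2017, Prop. 3.2 (proof)] -/
def fullSrc : LState n → MvPolynomial (Fin (n + 2) × Fin (n + 2)) k :=
  fun p => if (p.1 : ℕ) = 0 then start₀ k (n + 2) p.2 else 0

/-- Sink weights of the unpruned program: from the last layer `n` (after `m − 1` edges) the last edge
closes the last clow, whose head is the last vertex `m − 1` (IL17: "an edge to the sink labeled with
`α x^u_h`"; here the entry of `T₀` into the state `(m−1, m−1)`). [cite: IkenmeyerLandsberg2017, Prop. 3.2 (proof)] -/
def fullSnk : LState n → MvPolynomial (Fin (n + 2) × Fin (n + 2)) k :=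
  fun p => if (p.1 : ℕ) = n then T₀ k (n + 2) p.2 (Fin.last (n + 1), Fin.last (n + 1)) else 0

/-- **The pruned program** (IL17's `Γ`): the adjacency matrix restricted to the live states.
[cite: IkenmeyerLandsberg2017, Prop. 3.2 (proof)] -/
def prN : Matrix (Vtx n) (Vtx n) (MvPolynomial (Fin (n + 2) × Fin (n + 2)) k) :=
  Matrix.of fun v v' => fullN k n v.1 v'.1

/-- Source weights of the pruned program. [cite: IkenmeyerLandsberg2017, Prop. 3.2 (proof)] -/
def prSrc : Vtx n → MvPolynomial (Fin (n + 2) × Fin (n + 2)) k := fun v => fullSrc k n v.1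

/-- Sink weights of the pruned program. [cite: IkenmeyerLandsberg2017, Prop. 3.2 (proof)] -/
def prSnk : Vtx n → MvPolynomial (Fin (n + 2) × Fin (n + 2)) k := fun v => fullSnk k n v.1

/-- A vector supported on the layer `d`, with values `w` on its states. [folklore] -/
def layerVec (d : ℕ) (w : Fin (n + 2) × Fin (n + 2) → MvPolynomial (Fin (n + 2) × Fin (n + 2)) k) :
    LState n → MvPolynomial (Fin (n + 2) × Fin (n + 2)) k :=
  fun p => if (p.1 : ℕ) = d then w p.2 else 0

/-- The layer `d` of the signed dynamics `GKKP2011.sv` as a vector on the states. [folklore] -/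
def svVec (d : ℕ) : Fin (n + 2) × Fin (n + 2) → MvPolynomial (Fin (n + 2) × Fin (n + 2)) k :=
  fun σ => sv k (n + 2) d σ.1 σ.2

variable {k n}

/-! ### Layering: nilpotency and unipotency -/

/-- Entries of the pruned matrix. [folklore] -/
private theorem prN_apply (v v' : Vtx n) :
    prN k n v v' = if (v'.1.1 : ℕ) = v.1.1 + 1 then T₀ k (n + 2) v.1.2 v'.1.2 else 0 := rfl

/-- The pruned program is layered by the layer index. [cite: IkenmeyerLandsberg2017, Prop. 3.2 (proof)] -/
theorem prN_isLayered : IsLayered (prN k n) (fun v => (v.1.1 : ℕ)) := by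
  intro v v' h
  rw [prN_apply] at h
  by_contra hne
  exact h (if_neg hne)

/-- Hence `prN ^ (n + 1) = 0` (layers are `≤ n`). [folklore] -/
private theorem prN_pow_eq_zero : prN k n ^ (n + 1) = 0 :=
  (prN_isLayered (k := k) (n := n)).pow_eq_zero fun v => Nat.le_of_lt_succ v.1.1.isLt

/-- … and `det (1 + prN) = 1`. [folklore] -/
private theorem det_one_add_prN : (1 + prN k n).det = 1 :=
  (prN_isLayered (k := k) (n := n)).det_one_add

/-! ### The unpruned program runs the dynamics `sv` layer by layer -/

/-- Exactly one index of `Fin m` has value `d` when `d < m`, none otherwise. [folklore] -/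
private theorem sum_fin_val_eq {M : Type*} [AddCommMonoid M] (m d : ℕ) (c : M) :
    ∑ i : Fin m, (if (i : ℕ) = d then c else 0) = if d < m then c else 0 := by
  by_cases hd : d < m
  · rw [if_pos hd]
    have h : ∀ i : Fin m, ((i : ℕ) = d) = (i = ⟨d, hd⟩) := fun i => by rw [Fin.ext_iff]
    simp_rw [h]
    rw [Finset.sum_ite_eq', if_pos (Finset.mem_univ _)]
  · rw [if_neg hd]
    exact Finset.sum_eq_zero fun i _ => if_neg (by have := i.isLt; omega)

/-- **Layer propagation** in the unpruned program: a vector on layer `d` is sent to `w · T₀` on layer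
`d + 1`. [cite: IkenmeyerLandsberg2017, Prop. 3.2 (proof)] -/
theorem layerVec_vecMul_fullN (d : ℕ)
    (w : Fin (n + 2) × Fin (n + 2) → MvPolynomial (Fin (n + 2) × Fin (n + 2)) k) :
    layerVec k n d w ᵥ* fullN k n = layerVec k n (d + 1) (w ᵥ* T₀ k (n + 2)) := by
  funext p'
  obtain ⟨i', σ'⟩ := p'
  simp only [Matrix.vecMul, dotProduct, layerVec, fullN, Matrix.of_apply]
  rw [Fintype.sum_prod_type]
  have h1 : ∀ i : Fin (n + 1), ∑ σ : Fin (n + 2) × Fin (n + 2),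
      (if (i : ℕ) = d then w σ else 0) * (if (i' : ℕ) = i + 1 then T₀ k (n + 2) σ σ' else 0) =
        if (i : ℕ) = d then (if (i' : ℕ) = d + 1 then ∑ σ, w σ * T₀ k (n + 2) σ σ' else 0)
        else 0 := by
    intro i
    by_cases hi : (i : ℕ) = d
    · simp_rw [if_pos hi]
      rw [← hi]
      by_cases h' : (i' : ℕ) = i + 1
      · simp_rw [if_pos h']
      · simp_rw [if_neg h']
        simp
    · simp_rw [if_neg hi]
      simp
  rw [Finset.sum_congr rfl fun i _ => h1 i, sum_fin_val_eq]
  by_cases hd : d < n + 1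
  · rw [if_pos hd]
  · rw [if_neg hd, if_neg (by have := i'.isLt; omega)]

/-- The source row is the layer `0` of the dynamics (after one edge). [folklore] -/
private theorem fullSrc_eq : fullSrc k n = layerVec k n 0 (svVec k n 1) := by
  funext p
  simp only [fullSrc, layerVec, svVec, start₀_eq]

/-- **Paths of the unpruned program**: after `j` internal edges the source row sits on layer `j` as
the layer `j + 1` of the dynamics `sv`. [cite: IkenmeyerLandsberg2017, Prop. 3.2 (proof)] -/
theorem fullSrc_vecMul_pow (j : ℕ) :
    fullSrc k n ᵥ* fullN k n ^ j = layerVec k n j (svVec k n (j + 1)) := by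
  induction j with
  | zero => rw [pow_zero, Matrix.vecMul_one, fullSrc_eq]
  | succ j ih =>
    rw [pow_succ, ← Matrix.vecMul_vecMul, ih, layerVec_vecMul_fullN]
    congr 1
    exact sv_vecMul_T₀ (by omega)

/-! ### The pruning is harmless: dropped states carry `0` or feed no live state -/

/-- **Key to the pruning** (Mahajan–Vinay's "improvements", IL17 p0006:L36–L37): if the state
`(t, u)` after `i + 1` edges contributes through an edge of `T₀` into a state whose head is `≥ i + 1`,
then `(t, u)` is live — inside a clow this is the layering of heads, at a closed head it is the
vanishing `sv d t t = e (t+1) d − e t d = 0` for `d > t + 1` (`GKKP2011.sv_spec`, `e_of_lt`).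
[cite: IkenmeyerLandsberg2017, Prop. 3.2 (proof)] -/
theorem alive_of_ne_zero (i : Fin (n + 1)) (t u : Fin (n + 2)) (σ' : Fin (n + 2) × Fin (n + 2))
    (h : sv k (n + 2) ((i : ℕ) + 1) t u * T₀ k (n + 2) (t, u) σ' ≠ 0) (hle : (i : ℕ) + 1 ≤ σ'.1) :
    Alive n (i, (t, u)) := by
  show ((u : ℕ) < t ∧ (i : ℕ) < t) ∨ (u = t ∧ (i : ℕ) ≤ t ∧ (t : ℕ) ≤ n)
  have hT : T₀ k (n + 2) (t, u) σ' ≠ 0 := fun h0 => h (by rw [h0, mul_zero])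
  have hs : sv k (n + 2) ((i : ℕ) + 1) t u ≠ 0 := fun h0 => h (by rw [h0, zero_mul])
  simp only [T₀, Matrix.of_apply] at hT
  by_cases hut : (u : ℕ) < t
  · rw [if_pos hut] at hT
    have ht' : σ'.1 = t := by
      by_contra hne
      exact hT (if_neg hne)
    have : (σ'.1 : ℕ) = t := congrArg Fin.val ht'
    exact Or.inl ⟨hut, by omega⟩
  · rw [if_neg hut] at hT
    by_cases hut' : u = t
    · rw [if_pos hut'] at hT
      have htt' : (t : ℕ) < σ'.1 := by
        by_contra hne
        exact hT (if_neg hne)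
      refine Or.inr ⟨hut', ?_, by have := σ'.1.isLt; omega⟩
      by_contra hlt
      apply hs
      rw [hut', (sv_spec (k := k) (n := n + 2) ((i : ℕ) + 1)).2.1 t, e_of_lt (by omega),
        e_of_lt (by omega), sub_zero]
    · rw [if_neg hut'] at hT
      exact (hT rfl).elim

/-- A sum over the live states is the sum over all layer-states when the summand vanishes off the
live ones. [folklore] -/
private theorem sum_vtx_eq_sum {M : Type*} [AddCommMonoid M] (g : LState n → M)
    (hg : ∀ p, g p ≠ 0 → Alive n p) : ∑ v : Vtx n, g v.1 = ∑ p : LState n, g p := by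
  calc ∑ v : Vtx n, g v.1 = ∑ p ∈ Finset.univ.filter (Alive n), g p :=
        (Finset.sum_subtype (p := Alive n) (Finset.univ.filter (Alive n))
          (fun x => by simp only [Finset.mem_filter, Finset.mem_univ, true_and]) g).symm
    _ = ∑ p : LState n, g p := Finset.sum_filter_of_ne fun p _ hp => hg p hp

/-- A live state has its layer index at most its head. [folklore] -/
private theorem Alive.le_head {p : LState n} (h : Alive n p) : (p.1 : ℕ) ≤ p.2.1 := by
  rcases h with ⟨-, h⟩ | ⟨-, h, -⟩
  · exact h.le
  · exact h

/-- **The pruned program has the same layer vectors as the unpruned one** on its (live) states.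
[cite: IkenmeyerLandsberg2017, Prop. 3.2 (proof)] -/
theorem prSrc_vecMul_pow (j : ℕ) :
    prSrc k n ᵥ* prN k n ^ j = fun v => (fullSrc k n ᵥ* fullN k n ^ j) v.1 := by
  induction j with
  | zero =>
    rw [pow_zero, pow_zero, Matrix.vecMul_one, Matrix.vecMul_one]
    rfl
  | succ j ih =>
    rw [pow_succ, ← Matrix.vecMul_vecMul, ih, pow_succ, ← Matrix.vecMul_vecMul]
    funext v'
    have hR : ((fullSrc k n ᵥ* fullN k n ^ j) ᵥ* fullN k n) v'.1 =
        ∑ p : LState n, (fullSrc k n ᵥ* fullN k n ^ j) p * fullN k n p v'.1 := rfl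
    rw [hR, ← sum_vtx_eq_sum (fun p => (fullSrc k n ᵥ* fullN k n ^ j) p * fullN k n p v'.1)]
    · rfl
    · intro p hp
      obtain ⟨i, t, u⟩ := p
      rw [fullSrc_vecMul_pow] at hp
      simp only [layerVec, svVec, fullN, Matrix.of_apply] at hp
      by_cases hi : (i : ℕ) = j
      · rw [if_pos hi] at hp
        by_cases hi' : (v'.1.1 : ℕ) = i + 1
        · rw [if_pos hi'] at hp
          rw [← hi] at hp
          refine alive_of_ne_zero i t u v'.1.2 hp ?_
          have := v'.2.le_head
          omega
        · rw [if_neg hi', mul_zero] at hp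
          exact absurd rfl hp
      · rw [if_neg hi, zero_mul] at hp
        exact absurd rfl hp

/-! ### The value of the pruned program -/

/-- The sink weights against a layer of the dynamics: only the last layer `n` contributes, and it
contributes the value of the state `(m−1, m−1)` after `m` edges, `sv m (m−1) (m−1)` (`m = n + 2`).
[cite: IkenmeyerLandsberg2017, Prop. 3.2 (proof)] -/
theorem layerVec_svVec_dotProduct_fullSnk (j : ℕ) :
    ∑ p : LState n, layerVec k n j (svVec k n (j + 1)) p * fullSnk k n p =
      if j = n then sv k (n + 2) (n + 2) (n + 1) (n + 1) else 0 := by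
  -- the surviving sum is one step of the dynamics, read at the state `(m-1, m-1)`
  have hS : ∑ σ : Fin (n + 2) × Fin (n + 2),
      svVec k n (n + 1) σ * T₀ k (n + 2) σ (Fin.last (n + 1), Fin.last (n + 1)) =
        sv k (n + 2) (n + 2) (n + 1) (n + 1) := by
    have h := congrFun (sv_vecMul_T₀ (k := k) (n := n + 2) (d := n + 1) (by omega))
      (Fin.last (n + 1), Fin.last (n + 1))
    simp only [Matrix.vecMul, dotProduct, Fin.val_last] at h
    exact h
  have h1 : ∀ i : Fin (n + 1), ∑ σ : Fin (n + 2) × Fin (n + 2),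
      layerVec k n j (svVec k n (j + 1)) (i, σ) * fullSnk k n (i, σ) =
        if (i : ℕ) = j then (if j = n then sv k (n + 2) (n + 2) (n + 1) (n + 1) else 0)
        else 0 := by
    intro i
    simp only [layerVec, fullSnk]
    by_cases hi : (i : ℕ) = j
    · simp_rw [if_pos hi]
      rw [← hi]
      by_cases h' : (i : ℕ) = n
      · simp_rw [if_pos h']
        rw [← hS, h']
      · simp_rw [if_neg h']
        simp
    · simp_rw [if_neg hi]
      simp
  rw [Fintype.sum_prod_type, Finset.sum_congr rfl fun i _ => h1 i, sum_fin_val_eq]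
  by_cases hj : j = n
  · rw [if_pos (by omega), if_pos hj]
  · rw [if_neg hj]
    split_ifs <;> rfl

/-- **The value of the pruned program is the determinant**: `a · (1 + N)⁻¹ · b = det_{n+2}`
(IL17: "The fact that `Γ` actually computes `det_m` follows from [MV:97]"; here from
`GKKP2011.sv_spec`: the surviving state carries `e m m − e (m−1) m = [X⁰] χ(M_m) = (−1)^m det_m`, and
the `m − 2` internal edges of every path contribute `(−1)^m` through `(1 + N)⁻¹ = ∑ (−N)^j`).
[cite: IkenmeyerLandsberg2017, Prop. 3.2] -/
theorem abpValue_prN_eq_detPoly :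
    abpValue (geomInv (prN k n) (n + 1)) (prSrc k n) (prSnk k n) = detPoly (Fin (n + 2)) k := by
  have hterm : ∀ j ∈ range (n + 1), (prSrc k n ᵥ* (-prN k n) ^ j) ⬝ᵥ prSnk k n =
      if j = n then (-1) ^ n * sv k (n + 2) (n + 2) (n + 1) (n + 1) else 0 := by
    intro j _
    rw [← neg_one_smul (MvPolynomial (Fin (n + 2) × Fin (n + 2)) k) (prN k n), smul_pow,
      Matrix.vecMul_smul, smul_dotProduct, smul_eq_mul, prSrc_vecMul_pow, fullSrc_vecMul_pow]
    have hsum : (fun v : Vtx n => layerVec k n j (svVec k n (j + 1)) v.1) ⬝ᵥ prSnk k n =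
        ∑ p : LState n, layerVec k n j (svVec k n (j + 1)) p * fullSnk k n p := by
      refine sum_vtx_eq_sum (fun p => layerVec k n j (svVec k n (j + 1)) p * fullSnk k n p) ?_
      intro p hp
      obtain ⟨i, t, u⟩ := p
      simp only [layerVec, svVec, fullSnk] at hp
      by_cases hi : (i : ℕ) = j
      · rw [if_pos hi] at hp
        by_cases hi' : (i : ℕ) = n
        · rw [if_pos hi'] at hp
          rw [← hi] at hp
          exact alive_of_ne_zero i t u _ hp (by rw [Fin.val_last]; omega)
        · rw [if_neg hi', mul_zero] at hp
          exact absurd rfl hp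
      · rw [if_neg hi, zero_mul] at hp
        exact absurd rfl hp
    rw [hsum, layerVec_svVec_dotProduct_fullSnk]
    by_cases hj : j = n
    · rw [if_pos hj, if_pos hj, hj]
    · rw [if_neg hj, if_neg hj, mul_zero]
  have hsv : sv k (n + 2) (n + 2) (n + 1) (n + 1) = (chi k (n + 2) (n + 2)).coeff 0 := by
    rw [(sv_spec (k := k) (n := n + 2) (n + 2)).2.1 (n + 1), e_of_lt (show n + 1 < n + 2 by omega),
      sub_zero]
    unfold e
    rw [if_pos le_rfl, Nat.sub_self]
  unfold abpValue geomInv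
  rw [Matrix.dotProduct_mulVec, Matrix.vecMul_sum, sum_dotProduct, Finset.sum_congr rfl hterm,
    Finset.sum_ite_eq', if_pos (by simp), hsv, detPoly, ← genBlock_self,
    Matrix.det_eq_sign_charpoly_coeff, Fintype.card_fin, pow_add, neg_one_sq, mul_one]
  rfl

/-! ## Lemma 3.3: the vertex count -/

/-- `#{u < M : u < t} = min t M`. [folklore] -/
private theorem sum_range_ite_lt (M t : ℕ) : ∑ u ∈ range M, (if u < t then 1 else 0) = min t M := by
  induction M with
  | zero => simp
  | succ M ih =>
    rw [Finset.sum_range_succ, ih]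
    split_ifs with h
    · omega
    · omega

/-- `#{u < M : u ≤ t} = min (t + 1) M`. [folklore] -/
private theorem sum_range_ite_le (M t : ℕ) : ∑ u ∈ range M, (if u ≤ t then 1 else 0) = min (t + 1) M := by
  have h := sum_range_ite_lt M (t + 1)
  simp_rw [Nat.lt_succ_iff] at h
  exact h

/-- `6 ∑_{t ≤ M} t² = M (M+1) (2M+1)`. [folklore] -/
private theorem six_mul_sum_range_succ_sq (M : ℕ) :
    6 * ∑ t ∈ range (M + 1), t * t = M * (M + 1) * (2 * M + 1) := by
  induction M with
  | zero => simp
  | succ M ih =>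
    rw [Finset.sum_range_succ, mul_add, ih]
    ring

/-- `2 ∑_{t < M} (t + 1) = M (M + 1)`. [folklore] -/
private theorem two_mul_sum_range_add_one (M : ℕ) : 2 * ∑ t ∈ range M, (t + 1) = M * (M + 1) := by
  induction M with
  | zero => simp
  | succ M ih =>
    rw [Finset.sum_range_succ, mul_add, ih]
    ring

/-- The live states with head `t` after `i + 1` edges, counted over the current vertex `u`:
`t` of them inside the clow if `i < t`, plus the closed head if `i ≤ t ≤ n`. [cite: IkenmeyerLandsberg2017, Lemma 3.3] -/
theorem sum_alive_indicator (i : Fin (n + 1)) (t : Fin (n + 2)) :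
    ∑ u : Fin (n + 2), (if Alive n (i, (t, u)) then 1 else 0) =
      (if (i : ℕ) < t then (t : ℕ) else 0) + (if (i : ℕ) ≤ t ∧ (t : ℕ) ≤ n then 1 else 0) := by
  have hsplit : ∀ u : Fin (n + 2), (if Alive n (i, (t, u)) then 1 else 0) =
      (if (u : ℕ) < t then (if (i : ℕ) < t then 1 else 0) else 0) +
        (if u = t then (if (i : ℕ) ≤ t ∧ (t : ℕ) ≤ n then 1 else 0) else 0) := by
    intro u
    by_cases hu : (u : ℕ) < t
    · have hne : u ≠ t := fun h => by rw [h] at hu; exact lt_irrefl _ hu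
      simp [Alive, hu, hne]
    · by_cases hu' : u = t
      · subst hu'
        simp [Alive]
      · simp [Alive, hu, hu']
  simp_rw [hsplit]
  rw [Finset.sum_add_distrib, Finset.sum_ite_eq' Finset.univ t, if_pos (Finset.mem_univ _)]
  congr 1
  rw [Fin.sum_univ_eq_sum_range (fun u => if u < (t : ℕ) then (if (i : ℕ) < t then 1 else 0) else 0)
    (n + 2)]
  by_cases hi : (i : ℕ) < t
  · simp_rw [if_pos hi]
    rw [sum_range_ite_lt]
    have := t.isLt
    omega
  · simp_rw [if_neg hi]
    simp

/-- The live states after `i + 1` edges, counted head by head. [cite: IkenmeyerLandsberg2017, Lemma 3.3] -/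
theorem sum_alive_indicator' (i : Fin (n + 1)) :
    ∑ σ : Fin (n + 2) × Fin (n + 2), (if Alive n (i, σ) then 1 else 0) =
      ∑ t : Fin (n + 2), ((if (i : ℕ) < t then (t : ℕ) else 0) +
        (if (i : ℕ) ≤ t ∧ (t : ℕ) ≤ n then 1 else 0)) := by
  rw [Fintype.sum_prod_type]
  exact Finset.sum_congr rfl fun t _ => sum_alive_indicator i t

/-- **IL17 Lemma 3.3 (the vertex count, Berkowitz orientation)**: `3 · |Vtx n| = m³ − m` for
`m = n + 2`, i.e. `Γ` has `m³/3 − m/3 + 2` vertices with its source and sink (the count is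
`∑_t (t² + [t ≤ m−2](t+1))`: `t·t` inside states and `t + 1` closed ones per head `t`).
[cite: IkenmeyerLandsberg2017, Lemma 3.3] -/
theorem three_mul_card_vtx : 3 * Fintype.card (Vtx n) = (n + 2) ^ 3 - (n + 2) := by
  classical
  have hcard : Fintype.card (Vtx n) =
      ∑ t ∈ range (n + 2), (t * t + if t ≤ n then t + 1 else 0) := by
    rw [Fintype.card_subtype, Finset.card_filter, Fintype.sum_prod_type,
      Finset.sum_congr rfl fun i _ => sum_alive_indicator' i, Finset.sum_comm]
    simp_rw [Finset.sum_add_distrib]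
    congr 1
    · rw [Fin.sum_univ_eq_sum_range (fun t => ∑ i : Fin (n + 1), if (i : ℕ) < t then t else 0) (n + 2)]
      refine Finset.sum_congr rfl fun t ht => ?_
      have ht' := Finset.mem_range.1 ht
      have h1 : ∀ i : Fin (n + 1), (if (i : ℕ) < t then t else 0) = t * (if (i : ℕ) < t then 1 else 0) :=
        fun i => by split_ifs <;> simp
      simp_rw [h1]
      rw [← Finset.mul_sum, Fin.sum_univ_eq_sum_range (fun i => if i < t then 1 else 0) (n + 1),
        sum_range_ite_lt]
      have : min t (n + 1) = t := by omega
      rw [this]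
    · rw [Fin.sum_univ_eq_sum_range
        (fun t => ∑ i : Fin (n + 1), if (i : ℕ) ≤ t ∧ t ≤ n then 1 else 0) (n + 2)]
      refine Finset.sum_congr rfl fun t ht => ?_
      by_cases htn : t ≤ n
      · have h1 : ∀ i : Fin (n + 1), (if (i : ℕ) ≤ t ∧ t ≤ n then 1 else 0) =
            (if (i : ℕ) ≤ t then 1 else 0) := fun i => by simp [htn]
        simp_rw [h1]
        rw [Fin.sum_univ_eq_sum_range (fun i => if i ≤ t then 1 else 0) (n + 1), sum_range_ite_le,
          if_pos htn]
        omega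
      · have h1 : ∀ i : Fin (n + 1), (if (i : ℕ) ≤ t ∧ t ≤ n then 1 else 0) = 0 :=
          fun i => by simp [htn]
        simp_rw [h1]
        rw [Finset.sum_const_zero, if_neg htn]
  have hsum2 : 2 * ∑ t ∈ range (n + 2), (if t ≤ n then t + 1 else 0) = (n + 1) * (n + 2) := by
    rw [Finset.sum_range_succ, if_neg (by omega), add_zero]
    have h1 : ∑ t ∈ range (n + 1), (if t ≤ n then t + 1 else 0) = ∑ t ∈ range (n + 1), (t + 1) :=
      Finset.sum_congr rfl fun t ht => if_pos (by have := Finset.mem_range.1 ht; omega)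
    rw [h1, two_mul_sum_range_add_one]
  have hsum1 := six_mul_sum_range_succ_sq (n + 1)
  have h6 : 6 * Fintype.card (Vtx n) = 2 * ((n + 1) * (n + 2) * (n + 3)) := by
    have hsplit : 6 * Fintype.card (Vtx n) = 6 * ∑ t ∈ range (n + 1 + 1), t * t +
        3 * (2 * ∑ t ∈ range (n + 2), (if t ≤ n then t + 1 else 0)) := by
      rw [hcard, Finset.sum_add_distrib]
      ring
    rw [hsplit, hsum1, hsum2]
    ring
  have h3 : (n + 2) ^ 3 - (n + 2) = (n + 1) * (n + 2) * (n + 3) := by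
    have : (n + 2) ≤ (n + 2) ^ 3 := by nlinarith
    zify [this]
    ring
  rw [h3]
  omega

/-- Hence `|Vtx n| = (m³ − m)/3` (`m = n + 2`; `3 ∣ m³ − m`). [cite: IkenmeyerLandsberg2017, Lemma 3.3] -/
theorem card_vtx : Fintype.card (Vtx n) = ((n + 2) ^ 3 - (n + 2)) / 3 := by
  have h := three_mul_card_vtx (n := n)
  omega

/-! ## Prop. 2.3: the regular representation of size `(m³ − m)/3 + 1` -/

/-- Entries `xvar a b` (a variable or `0`) are affine. [folklore] -/
private theorem totalDegree_xvar_le [Nontrivial k] (m a b : ℕ) : (xvar k m a b).totalDegree ≤ 1 := by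
  unfold xvar
  split_ifs
  · exact (totalDegree_X _).le
  · rw [totalDegree_zero]; exact zero_le_one

/-- The signed edge weights `stepW` (`X`, `−X` or `0`) are affine. [folklore] -/
private theorem totalDegree_stepW_le [Nontrivial k] (m f t u : ℕ) : (stepW k m f t u).totalDegree ≤ 1 := by
  unfold stepW
  split_ifs
  · exact totalDegree_xvar_le m f u
  · rw [totalDegree_neg]; exact totalDegree_xvar_le m f t
  · rw [totalDegree_zero]; exact zero_le_one

/-- The entries of `T₀` are affine. [folklore] -/
private theorem totalDegree_T₀_le [Nontrivial k] (m : ℕ) (σ σ' : Fin m × Fin m) : (T₀ k m σ σ').totalDegree ≤ 1 := by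
  simp only [T₀, Matrix.of_apply]
  split_ifs
  · exact totalDegree_stepW_le _ _ _ _
  · rw [totalDegree_zero]; exact zero_le_one
  · exact totalDegree_stepW_le _ _ _ _
  · rw [totalDegree_zero]; exact zero_le_one
  · rw [totalDegree_zero]; exact zero_le_one

/-- The entries of the pruned matrix are affine. [folklore] -/
private theorem totalDegree_prN_le [Nontrivial k] (v v' : Vtx n) : (prN k n v v').totalDegree ≤ 1 := by
  rw [prN_apply]
  split_ifs
  · exact totalDegree_T₀_le _ _ _
  · rw [totalDegree_zero]; exact zero_le_one

/-- The source weights are affine. [folklore] -/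
private theorem totalDegree_prSrc_le [Nontrivial k] (v : Vtx n) : (prSrc k n v).totalDegree ≤ 1 := by
  simp only [prSrc, fullSrc, start₀]
  split_ifs
  · exact totalDegree_stepW_le _ _ _ _
  · rw [totalDegree_zero]; exact zero_le_one

/-- The sink weights are affine. [folklore] -/
private theorem totalDegree_prSnk_le [Nontrivial k] (v : Vtx n) : (prSnk k n v).totalDegree ≤ 1 := by
  simp only [prSnk, fullSnk]
  split_ifs
  · exact totalDegree_T₀_le _ _ _
  · rw [totalDegree_zero]; exact zero_le_one

/-- `|Fin 1 ⊕ Vtx n| = (m³ − m)/3 + 1`: the size of IL17's regular matrix (root = merged source/sink).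
[cite: IkenmeyerLandsberg2017, Prop. 2.3] -/
theorem card_root_sum_vtx : Fintype.card (Fin 1 ⊕ Vtx n) = ((n + 2) ^ 3 - (n + 2)) / 3 + 1 := by
  rw [Fintype.card_sum, Fintype.card_fin, card_vtx, add_comm]

end IL17

open IL17 in
/-- **IL17 Prop. 2.3 with the printed constant, `m = n + 2 ≥ 2`, any field**: `det_{n+2}` has a REGULAR
affine determinantal representation of size exactly `((n+2)³ − (n+2))/3 + 1` — Prop. 3.1's matrix
`[[0, −aᵀ], [b, 1 + N]]` (`det_fromBlocks_abp`, `rank_constPart_fromBlocks_abp`) on the pruned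
Mahajan–Vinay program `IL17.prN` of Prop. 3.2 (`(m³ − m)/3` internal vertices, `IL17.card_vtx`; value
`det_m`, `IL17.abpValue_prN_eq_detPoly`). [cite: IkenmeyerLandsberg2017, Prop. 2.3, Prop. 3.1, Prop. 3.2] -/
theorem hasRegularDetRepr_detPoly_add_two (k : Type*) [Field k] (n : ℕ) :
    HasRegularDetRepr (detPoly (Fin (n + 2)) k) (((n + 2) ^ 3 - (n + 2)) / 3 + 1) := by
  classical
  obtain ⟨e⟩ : Nonempty (Fin 1 ⊕ IL17.Vtx n ≃ Fin (((n + 2) ^ 3 - (n + 2)) / 3 + 1)) :=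
    ⟨Fintype.equivFinOfCardEq card_root_sum_vtx⟩
  have hG := GKKP2011.one_add_mul_geomInv (prN_pow_eq_zero (k := k) (n := n))
  have hdetF := GKKP2011.det_fromBlocks_abp (prN k n) (GKKP2011.geomInv (prN k n) (n + 1))
    (prSrc k n) (prSnk k n) hG det_one_add_prN
  rw [abpValue_prN_eq_detPoly] at hdetF
  refine ⟨Matrix.reindex e e (Matrix.fromBlocks
      (0 : Matrix (Fin 1) (Fin 1) (MvPolynomial (Fin (n + 2) × Fin (n + 2)) k))
      (Matrix.replicateRow (Fin 1) (-prSrc k n)) (Matrix.replicateCol (Fin 1) (prSnk k n))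
      (1 + prN k n)), ⟨fun i j => ?_, ?_⟩, ?_⟩
  · -- affine entries
    rw [Matrix.reindex_apply, Matrix.submatrix_apply]
    rcases e.symm i with u | v <;> rcases e.symm j with u' | v'
    · rw [Matrix.fromBlocks_apply₁₁, Matrix.zero_apply, totalDegree_zero]; exact zero_le_one
    · rw [Matrix.fromBlocks_apply₁₂, Matrix.replicateRow_apply, Pi.neg_apply, totalDegree_neg]
      exact totalDegree_prSrc_le v'
    · rw [Matrix.fromBlocks_apply₂₁, Matrix.replicateCol_apply]
      exact totalDegree_prSnk_le v
    · rw [Matrix.fromBlocks_apply₂₂, Matrix.add_apply, Matrix.one_apply]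
      refine (totalDegree_add _ _).trans (max_le ?_ (totalDegree_prN_le v v'))
      split_ifs <;> simp
  · -- determinant
    rw [Matrix.det_reindex_self, hdetF]
  · -- regularity: `rank Λ = size - 1`
    have hrk := GKKP2011.rank_constPart_fromBlocks_abp (prN k n) (prSrc k n) (prSnk k n)
      det_one_add_prN (by rw [hdetF, constantCoeff_detPoly k (by omega)])
    rw [show constPart (Matrix.reindex e e _) = Matrix.reindex e e (constPart _) from rfl,
      Matrix.rank_reindex, hrk, card_vtx]
    rfl

/-- `m = 0`: the empty matrix is a regular representation of `det_0 = 1` (size `0`; `rank Λ = 0 =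
0 − 1` in `ℕ`). [cite: IkenmeyerLandsberg2017, Prop. 2.3] -/
theorem hasRegularDetRepr_detPoly_zero (k : Type*) [Field k] :
    HasRegularDetRepr (detPoly (Fin 0) k) 0 := by
  refine ⟨0, ⟨fun i => Fin.elim0 i, ?_⟩, ?_⟩
  · rw [detPoly, Matrix.det_isEmpty, Matrix.det_isEmpty]
  · exact le_antisymm (Matrix.rank_le_width _) (Nat.zero_le _)

/-- `m = 1`: `(X₀₀)` is a regular representation of `det_1 = X₀₀` (size `1`, `Λ = 0`).
[cite: IkenmeyerLandsberg2017, Prop. 2.3] -/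
theorem hasRegularDetRepr_detPoly_one (k : Type*) [Field k] :
    HasRegularDetRepr (detPoly (Fin 1) k) 1 := by
  refine ⟨Matrix.mvPolynomialX (Fin 1) (Fin 1) k, ⟨fun i j => ?_, rfl⟩, ?_⟩
  · rw [Matrix.mvPolynomialX_apply]
    exact (totalDegree_X _).le
  · have h0 : constPart (Matrix.mvPolynomialX (Fin 1) (Fin 1) k) = 0 := by
      ext i j
      rw [constPart_apply, Matrix.mvPolynomialX_apply, constantCoeff_X, Matrix.zero_apply]
    rw [h0, Matrix.rank_zero]

/-- **IL17 Prop. 2.3 over every field, all `m`**: `det_m` has a regular affine determinantal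
representation of some size `≤ (m³ − m)/3 + 1`. [cite: IkenmeyerLandsberg2017, Prop. 2.3] -/
theorem exists_hasRegularDetRepr_detPoly (k : Type*) [Field k] (m : ℕ) :
    ∃ s : ℕ, s ≤ (m ^ 3 - m) / 3 + 1 ∧ HasRegularDetRepr (detPoly (Fin m) k) s := by
  rcases m with _ | _ | n
  · exact ⟨0, Nat.zero_le _, hasRegularDetRepr_detPoly_zero k⟩
  · exact ⟨1, by norm_num, hasRegularDetRepr_detPoly_one k⟩
  · exact ⟨_, le_rfl, hasRegularDetRepr_detPoly_add_two k n⟩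

/-- Hence **`rdc(det_m) ≤ (m³ − m)/3 + 1`** over every field (IL17 Prop. 2.3 as printed; the tree's
`regularDetComplexity`). This sharpens `regularDetComplexity_detPoly_le_cubic` (`2m³ + 3`).
[cite: IkenmeyerLandsberg2017, Prop. 2.3] -/
theorem regularDetComplexity_detPoly_le_il17 (k : Type*) [Field k] (m : ℕ) :
    regularDetComplexity (detPoly (Fin m) k) ≤ (m ^ 3 - m) / 3 + 1 := by
  obtain ⟨s, hs, h⟩ := exists_hasRegularDetRepr_detPoly k m
  exact (regularDetComplexity_le h).trans hs

/-- Discharge of the named fact `ikenmeyerLandsberg2017_prop_2_3` (`LR17EquivariantRepresentations.lean`):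
over `ℂ`, for every `m` there is `n ≤ (m³ − m)/3 + 1` with `HasRegularDetRepr (detPoly (Fin m) ℂ) n`.
[cite: IkenmeyerLandsberg2017, Prop. 2.3] -/
theorem ikenmeyerLandsberg2017_prop_2_3_holds : ikenmeyerLandsberg2017_prop_2_3 :=
  fun m => exists_hasRegularDetRepr_detPoly ℂ m

end Literature.Computability.AlgebraicComplexity

end
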